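import Literature.NumberTheory.EllipticCurves.ComplexMultiplicationBurungaleFlachPrimaryProofs
import Literature.NumberTheory.EllipticCurves.ComplexMultiplicationShaRubinProofs
import Literature.NumberTheory.EllipticCurves.BSDInvariantsProofs
import Literature.NumberTheory.EllipticCurves.DivisionPolynomialTorsion
import Literature.NumberTheory.EllipticCurves.QuadraticTwistRank
import HarnessLib

/-!
# bsd.S28 (Burungale–Flach): the finiteness half of Theorem 1.1 over the CM field from its
classical sources (Coates–Wiles 1977, Rubin 1987), by Remark 10 of the paper

Fifth proof file of `Literature.NumberTheory.EllipticCurves.ComplexMultiplication` for **bsd.S28**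
(`Literature.NumberTheory.EllipticCurves.bsdTriple_of_j_mem_maximalCMJInvariants_of_L_one_ne_zero`:
the full Birch–Swinnerton-Dyer statement for `E/ℚ` with CM by a maximal order `𝓞_K` and
`L(E,1) ≠ 0`; Burungale–Flach, Camb. J. Math. 12 (2024), Thm. 1.1 and Cor. 2); sibling of
`ComplexMultiplicationBurungaleFlachPrimaryProofs.lean`, which left bsd.S28 resting, sorry-free,
on eleven named facts, two of them transcriptions of the paper itself at `F = K`:

* `Literature.NumberTheory.EllipticCurves.BurungaleFlach2024_finite_primary_cmField` — the
  finiteness half (**Prop. 4.1**, last assertion, as used on arXiv p. 22): for the base change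
  `E_K` of a CM curve `E/ℚ` (`j(E) ∈ maximalCMJInvariants`, `L(E/ℚ,1) ≠ 0`) to its CM field `K`
  and a globally minimal model `W'` of `E_K`, the groups `E(K) = W'(K)` and `Ш(E/K)[p^∞]` are
  finite for every rational prime `p`;
* `Literature.NumberTheory.EllipticCurves.BurungaleFlach2024_main_cmField_pPart` — the `p`-part
  of the `K`-equivariant formula (**Prop. 2.3 with Lemma 13**), the Iwasawa-theoretic heart.

The paper itself attributes the first of these to the classical literature — **Remark 10**
(arXiv p. 19): *"In the situation of Prop. (descent) the finiteness of the Mordell–Weil group is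
due to Coates and Wiles [coates77], Arthaud [arthuad78] and Rubin [rubin81]. For `L = K` the
finiteness of the Tate–Shafarevich group is due to Rubin [rubin87]"* — and both classical results
are already vendored in the tree as named facts serving the other two parts of bsd.S28:
Coates–Wiles, Thm. 1 over `ℚ` read against Mordell–Weil
(`Literature.NumberTheory.EllipticCurves.finite_point_of_j_mem_maximalCMJInvariants_of_L_one_ne_zero`,
the Mordell–Weil part of bsd.S28, itself reduced to the printed Theorem 1 and Mordell–Weil in
the parent file) and Rubin 1987, §10 for `E_K`
(`Literature.NumberTheory.EllipticCurves.Rubin1987_sha_primary_finite`, level 2 of the `Ш` part).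
This file **derives the finiteness half from them**, so that it stops being a leaf:

* `BurungaleFlach2024_finite_primary_cmField_of_classical` (**proved**): the finiteness half
  follows from Coates–Wiles finiteness over `ℚ` (`hF1`), the `ℚ`-isogeny `E ∼ E^{(d_K)}` of a CM
  curve with its twist by the CM character (`hTW`, Milne 1972 Thm. 3, already a leaf of the
  descent), Knapp 11.67 (`hKn`, isogenous curves have the same `L`-function, already a leaf),
  Rubin 1987 §10 (`hR`), Deuring's `L(E_K/K,s) = L(E/ℚ,s)²` (`hD`, already a leaf) and
  modularity (`hmod`, already a leaf). The glue, all proved here or in the tree: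
  - `E(K)` is finite as soon as `E(ℚ)` and `E^{(d_K)}(ℚ)` are
    (`WeierstrassCurve.finite_point_baseChange_of_finite_of_finite_quadraticTwist`: the
    eigenspace decomposition `2·E(K) ⊆ ι E(F) + τ E^{(c)}(F)` under `Gal(K/F)` of
    `QuadraticTwistRank.lean`, Silverman *AEC* Exercise 10.16, together with the finiteness of
    `E(K)[2]`, Silverman *AEC* III.6.4 = `WeierstrassCurve.finite_torsionBy_baseChange`); here
    `E^{(d_K)}(ℚ)` is finite by Coates–Wiles applied to the twist, which has the same
    `j`-invariant and, being `ℚ`-isogenous to `E`, the same value `L(E^{(d_K)},1) = L(E,1) ≠ 0`;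
  - finiteness of `E(K)` and of `Ш(E/K)[p^∞]` are invariant under admissible changes of
    variables over `K` (`VariableChange.pointEquiv`; the tree's `WeierstrassCurve.shaEquiv`, which is
    additive as a restriction of `galH1Equiv`, Silverman *AEC* X.§4), which carries the
    statements from `W.baseChange K` (where Rubin's fact lives) to the globally minimal model
    `W' = C • W.baseChange K` of the leaf;
  - `L(E_K/K, 1) = L(E/ℚ, 1)² ≠ 0` (`entireLFunction_one_eq_sq_of_LFunction_eq_mul_self`).
* `bsdTriple_of_j_mem_maximalCMJInvariants_of_L_one_ne_zero_of_pPart_of_classical` and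
  `…_of_pPart_of_printed_sources` (**proved**): bsd.S28 from the `p`-part leaf
  `BurungaleFlach2024_main_cmField_pPart` and classical named facts only.

After this file bsd.S28 (formula part) rests, sorry-free, on: Burungale–Flach Prop. 2.3 with
Lemma 13 at `F = K` for every `p` (the two-variable main conjecture of Johnson-Leung–Kings, its
descent and Kato's explicit reciprocity law — the contribution of the paper for `𝔭 ∣ #𝓞_K^×`,
Rubin 1991 for `𝔭 ∤ #𝓞_K^×`), and otherwise only on facts printed before 2010 that the other
parts of bsd.S28 already use: Coates–Wiles 1977 Thm. 1 with Mordell–Weil, Rubin 1987 §10,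
Deuring, modularity, the CM period lattice (singular moduli), Milne 1972 (Weil restriction and
the CM twist isogeny), Cassels' isogeny invariance, Knapp 11.67 and the sign `L(E,1) ≥ 0`.

## Design and faithfulness notes

* Nothing is restated: the two classical inputs are the tree's existing named facts, consumed as
  hypotheses; the conclusion is literally the level-4 leaf. No statement of the tree is edited.
* The quadratic descent of finiteness is proved for any field `F` with `2 ≠ 0`, any quadratic
  `K = F(θ)`, `θ² = c ∉ F²`, and any elliptic `W/F` (same setting and universe conventions as
  `WeierstrassCurve.finite_torsionBy_baseChange`: `F, K : Type u`).
* Group rules of the topic: `noncomputable section`, `open scoped Classical`; curve-specific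
  declarations are deliberate dot-notation extensions in `namespace WeierstrassCurve`, the bsd.S28
  material is in `namespace Literature.NumberTheory.EllipticCurves`.

## References

* A. Burungale, M. Flach, *The conjecture of Birch and Swinnerton-Dyer for certain elliptic curves
  with complex multiplication*, Camb. J. Math. 12 (2024) (arXiv:2206.09874): Thm. 1.1 (p. 3),
  Prop. 4.1 and Remark 10 (p. 19), proof of Thm. 1.1 (p. 22). [BurungaleFlach2024]
* K. Rubin, *Tate–Shafarevich groups and L-functions of elliptic curves with complex
  multiplication*, Invent. Math. 89 (1987), §10. [Rubin1987Sha]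
* J. Coates, A. Wiles, *On the conjecture of Birch and Swinnerton-Dyer*, Invent. Math. 39 (1977),
  Thm. 1. [CoatesWiles1977]
* J. H. Silverman, *The Arithmetic of Elliptic Curves*, 2nd ed., GTM 106 (2009), III.6.4, X.§4,
  X.5.4, Exercise 10.16. [SilvermanAEC2009]
-/

noncomputable section

open scoped Classical

universe u

/-! ### Generic glue: `p`-primary subsets along additive isomorphisms -/

namespace Literature.NumberTheory.EllipticCurves

/-- An additive isomorphism identifies the `p`-primary subsets `{a | ∃ j, pʲ a = 0}`. [folklore] -/
theorem preimage_setOf_primary_eq_of_addEquiv {A B : Type*} [AddCommGroup A] [AddCommGroup B]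
    (e : A ≃+ B) (p : ℕ) :
    e ⁻¹' {b : B | ∃ j : ℕ, p ^ j • b = 0} = {a : A | ∃ j : ℕ, p ^ j • a = 0} := by
  ext a
  simp only [Set.mem_preimage, Set.mem_setOf_eq, ← map_nsmul, EmbeddingLike.map_eq_zero_iff]

/-- Finiteness of the `p`-primary subset is invariant under additive isomorphisms. [folklore] -/
theorem finite_setOf_primary_iff_of_addEquiv {A B : Type*} [AddCommGroup A] [AddCommGroup B]
    (e : A ≃+ B) (p : ℕ) :
    Set.Finite {b : B | ∃ j : ℕ, p ^ j • b = 0} ↔ Set.Finite {a : A | ∃ j : ℕ, p ^ j • a = 0} := by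
  constructor
  · intro h
    rw [← preimage_setOf_primary_eq_of_addEquiv e p]
    exact Set.Finite.preimage e.injective.injOn h
  · intro h
    have h' := h.image e
    rwa [← preimage_setOf_primary_eq_of_addEquiv e p, Set.image_preimage_eq _ e.surjective] at h'

end Literature.NumberTheory.EllipticCurves

namespace WeierstrassCurve

/-! ### `Ш(E/K)[p^∞]` under an admissible change of variables -/

section VariableChange

variable {K : Type u} [Field K] [NumberField K] (W : WeierstrassCurve K) (C : VariableChange K)

/-- **Finiteness of `Ш(E/K)[p^∞]` is invariant under admissible changes of variables** (in the
form `Set.Finite {c ∈ Ш | ∃ j, pʲ c = 0}` of `ShaTorsion.lean` and `Rubin1987_sha_primary_finite`):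
the tree's bijection `WeierstrassCurve.shaEquiv W C : Ш(W/K) ≃ Ш(C • W/K)` is the restriction of
the additive isomorphism `galH1Equiv W C : H¹(K, E) ≃+ H¹(K, E')` induced by the change of
variables, hence additive, and additive isomorphisms identify `p`-primary subsets. Silverman,
*AEC*, X.§4 (`Ш` is attached to `E/K`, not to an equation). [cite: SilvermanAEC2009, X.§4] -/
theorem finite_sha_primary_variableChange_iff (p : ℕ) :
    Set.Finite {c : (C • W).sha | ∃ j : ℕ, p ^ j • c = 0} ↔
      Set.Finite {c : W.sha | ∃ j : ℕ, p ^ j • c = 0} :=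
  Literature.NumberTheory.EllipticCurves.finite_setOf_primary_iff_of_addEquiv
    ({ shaEquiv W C with
       map_add' := fun a b =>
         Subtype.ext (map_add (galH1Equiv W C) (a : W.galH1) (b : W.galH1)) } :
      W.sha ≃+ (C • W).sha) p

end VariableChange

/-! ### Finiteness of `E(K)` over a quadratic extension from `E(F)` and `E^{(c)}(F)` -/

section Quadratic

variable {F : Type u} {K : Type u} [Field F] [Field K] [Algebra F K] [NeZero (2 : F)]
  (W : WeierstrassCurve F) (h2 : Module.finrank F K = 2) {θ : K} {c : F}
  (hθ : θ ∉ Set.range (algebraMap F K)) (hc : θ ^ 2 = algebraMap F K c)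

open QuadraticDescent Literature.NumberTheory.QuadraticFields

include h2 hθ hc in
/-- **`E'(K)` is finite if `E'(F)` and `E^{(c)}(F)` are**, for the completed-square model
`E' = W^{(1)}` of an elliptic curve `W/F` (`2 ≠ 0`) and `K = F(θ)`, `θ² = c`, `θ ∉ F`: with
`ι : E'(F) → E'(K)` the inclusion, `τ : E^{(c)}(F) → E'(K)` the twisting map and `σ` the
conjugation of `K/F`, every `P ∈ E'(K)` has `P + σP ∈ ι E'(F)` and `P - σP ∈ τ E^{(c)}(F)`
(the eigenspace decomposition of `QuadraticTwistRank.lean`), so `2·E'(K)` lies in the finite set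
`ι E'(F) + τ E^{(c)}(F)`; and doubling has finite fibres on `E'(K)` because `E'(K)[2]` is finite
(Silverman, *AEC*, III.6.4: `WeierstrassCurve.finite_torsionBy_baseChange`).
Silverman, *AEC*, Exercise 10.16 (the decomposition) and Cor. III.6.4.
[cite: SilvermanAEC2009, Exercise 10.16 and Cor. III.6.4] -/
theorem finite_point_baseChange_quadraticTwist_one_of_finite [W.IsElliptic]
    (hF : Finite (W.quadraticTwist 1).toAffine.Point)
    (hT : Finite (W.quadraticTwist c).toAffine.Point) :
    Finite ((W.quadraticTwist 1).baseChange K).toAffine.Point := by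
  set σ := Quadratic.conj h2 hθ hc with hσdef
  have hσσ : ∀ z, σ (σ z) = z := Quadratic.conj_conj h2 hθ hc
  set V := W.quadraticTwist 1 with hV
  haveI : V.IsElliptic := W.isElliptic_quadraticTwist one_ne_zero
  haveI := hF
  haveI := hT
  -- fixed points of `σ` come from `F`, anti-fixed points from the twist
  have hfix : ∀ P : (V.baseChange K).toAffine.Point, conjMap V σ P = P →
      P ∈ Set.range (incl K V) := by
    rintro (_ | ⟨x, y, h⟩) hP
    · exact ⟨0, (map_zero _).trans Affine.Point.zero_def⟩
    · rw [Affine.Point.map_some, Affine.Point.some.injEq] at hP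
      obtain ⟨a, ha⟩ := Quadratic.exists_eq_algebraMap_of_conj_eq h2 hθ hc hP.1
      obtain ⟨b, hb⟩ := Quadratic.exists_eq_algebraMap_of_conj_eq h2 hθ hc hP.2
      obtain ⟨Q, hQ⟩ := exists_incl_eq V h ha.symm hb.symm
      exact ⟨Q, hQ⟩
  have hanti : ∀ P : (V.baseChange K).toAffine.Point, conjMap V σ P = -P →
      P ∈ Set.range (twistMap W hθ hc) := by
    rintro (_ | ⟨x, y, h⟩) hP
    · exact ⟨0, (map_zero _).trans Affine.Point.zero_def⟩
    · rw [Affine.Point.map_some, Affine.Point.neg_some, Affine.Point.some.injEq,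
        negY_quadraticTwist_one_baseChange] at hP
      obtain ⟨a, ha⟩ := Quadratic.exists_eq_algebraMap_of_conj_eq h2 hθ hc hP.1
      obtain ⟨b, hb⟩ := Quadratic.exists_eq_mul_of_conj_eq_neg h2 hθ hc hP.2
      obtain ⟨R, hR⟩ := exists_twistMap_eq W hθ hc h ha.symm hb.symm
      exact ⟨R, hR⟩
  -- `2P ∈ ι(E'(F)) + τ(E^{(c)}(F))`, a finite set
  set S : Set (V.baseChange K).toAffine.Point :=
    Set.range (fun QR : V.toAffine.Point × (W.quadraticTwist c).toAffine.Point =>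
      incl K V QR.1 + twistMap W hθ hc QR.2) with hS
  have hSfin : S.Finite := Set.finite_range _
  set D : (V.baseChange K).toAffine.Point →+ (V.baseChange K).toAffine.Point :=
    zsmulAddGroupHom (2 : ℤ) with hD
  have hDS : ∀ P, D P ∈ S := by
    intro P
    obtain ⟨Q, hQ⟩ := hfix (P + conjMap V σ P) (by rw [map_add, conjMap_conjMap V hσσ, add_comm])
    obtain ⟨R, hR⟩ := hanti (P - conjMap V σ P) (by rw [map_sub, conjMap_conjMap V hσσ, neg_sub])
    refine ⟨(Q, R), ?_⟩
    show incl K V Q + twistMap W hθ hc R = (2 : ℤ) • P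
    rw [hQ, hR, two_zsmul]
    abel
  -- doubling has finite fibres: its kernel `E'(K)[2]` is finite
  have hker : (D.ker : Set (V.baseChange K).toAffine.Point).Finite := by
    haveI : Finite (AddSubgroup.torsionBy (V.baseChange K).toAffine.Point (2 : ℤ)) :=
      V.finite_torsionBy_baseChange K two_ne_zero
    refine (Set.toFinite
      (AddSubgroup.torsionBy (V.baseChange K).toAffine.Point (2 : ℤ) : Set _)).subset ?_
    intro P hP
    rw [SetLike.mem_coe, AddMonoidHom.mem_ker] at hP
    rw [SetLike.mem_coe, Literature.NumberTheory.EllipticCurves.mem_torsionBy_iff]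
    exact hP
  have hpre : (D ⁻¹' S).Finite := hSfin.preimage' fun b _ =>
    Literature.NumberTheory.EllipticCurves.finite_preimage_singleton_of_finite_ker D hker b
  exact Set.finite_univ_iff.mp (hpre.subset fun P _ => hDS P)

include h2 hθ hc in
/-- **Finiteness of `E(K)` over a quadratic extension from `E(F)` and the twist**: for a field
`F` with `2 ≠ 0`, a quadratic extension `K = F(θ)`, `θ² = c ∈ F`, `θ ∉ F`, and an elliptic curve
`W/F`, if `W(F)` and `W^{(c)}(F)` are finite then so is `W(K)` — the finiteness (rank-and-torsion)
shadow of `rank E(K) = rank E(F) + rank E^{(c)}(F)` (Silverman, *AEC*, Exercise 10.16), reduced to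
the completed-square model `W^{(1)} ≅ W` over `F` and over `K`
(`finite_point_baseChange_quadraticTwist_one_of_finite`).
[cite: SilvermanAEC2009, Exercise 10.16 and Cor. III.6.4] -/
theorem finite_point_baseChange_of_finite_of_finite_quadraticTwist [W.IsElliptic]
    (hF : Finite W.toAffine.Point) (hT : Finite (W.quadraticTwist c).toAffine.Point) :
    Finite (W.baseChange K).toAffine.Point := by
  obtain ⟨C, hC⟩ := W.exists_variableChange_quadraticTwist_one
  have hCK : C.map (algebraMap F K) • W.baseChange K = (W.quadraticTwist 1).baseChange K := by
    rw [baseChange, baseChange, map_variableChange, hC]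
  have e1 : W.toAffine.Point ≃+ (W.quadraticTwist 1).toAffine.Point :=
    (VariableChange.pointEquiv W C).trans (Affine.Point.congrEquiv hC)
  have e2 : (W.baseChange K).toAffine.Point ≃+ ((W.quadraticTwist 1).baseChange K).toAffine.Point :=
    (VariableChange.pointEquiv (W.baseChange K) (C.map (algebraMap F K))).trans
      (Affine.Point.congrEquiv hCK)
  haveI : Finite (W.quadraticTwist 1).toAffine.Point := Finite.of_equiv _ e1.toEquiv
  haveI := finite_point_baseChange_quadraticTwist_one_of_finite W h2 hθ hc inferInstance hT
  exact Finite.of_equiv _ e2.toEquiv.symm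

end Quadratic

end WeierstrassCurve

/-! ### The finiteness half of Theorem 1.1 at `F = K` from Coates–Wiles and Rubin 1987 -/

namespace Literature.NumberTheory.EllipticCurves

open WeierstrassCurve

/-- **Burungale–Flach 2024, Prop. 4.1 (finiteness half) at `F = K`, from its classical sources
(Remark 10 of the paper).** The level-4 leaf `BurungaleFlach2024_finite_primary_cmField`
(`E(K)` and `Ш(E/K)[p^∞]` finite for every `p`, for the base change `E_K` of `E/ℚ` with
`j(E) ∈ maximalCMJInvariants`, `L(E/ℚ,1) ≠ 0`, on a globally minimal model `W' = C • E_K`) follows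
from: Coates–Wiles 1977, Thm. 1 over `ℚ` read against Mordell–Weil (`hF1`:
`finite_point_of_j_mem_maximalCMJInvariants_of_L_one_ne_zero`); the `ℚ`-isogeny of a CM curve with
its twist by the CM character (`hTW`, Milne 1972 Thm. 3 as quoted by Burungale–Flach, proof of
Cor. 2) and Knapp 11.67 (`hKn`), which give `L(E^{(d_K)},1) = L(E,1) ≠ 0` and hence, by `hF1`
for the twist (same `j`-invariant), `E^{(d_K)}(ℚ)` finite, so `E(K)` finite
(`finite_point_baseChange_of_finite_of_finite_quadraticTwist`); Rubin 1987, §10 for `E_K` (`hR`: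
`Rubin1987_sha_primary_finite`), whose hypothesis `L(E_K/K,1) ≠ 0` is `L(E/ℚ,1)² ≠ 0` by Deuring
(`hD`) and modularity (`hmod`); and the invariance of both finiteness statements under the
`K`-isomorphism `E_K ≅ W'` (`VariableChange.pointEquiv`, `finite_sha_primary_variableChange_iff`).
Burungale–Flach, Remark 10: *"the finiteness of the Mordell–Weil group is due to Coates and Wiles,
Arthaud and Rubin. For `L = K` the finiteness of the Tate–Shafarevich group is due to Rubin
[rubin87]"*. [cite: BurungaleFlach2024, Prop. 4.1 with Remark 10 (arXiv p. 19)]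
[cite: CoatesWiles1977, Thm 1 (p. 223)] [cite: Rubin1987Sha, §10, proof of Thm. A, p. 549] -/
theorem BurungaleFlach2024_finite_primary_cmField_of_classical
    (hF1 : finite_point_of_j_mem_maximalCMJInvariants_of_L_one_ne_zero)
    (hTW : isIsogenous_quadraticTwist_cmFieldDiscr) (hKn : LFunction_eq_of_isIsogenous)
    (hR : Rubin1987_sha_primary_finite) (hD : Deuring_LFunction_baseChange_cmField)
    (hmod : hasEntireLFunction_rat) : BurungaleFlach2024_finite_primary_cmField := by
  intro W _ hj hL K _ _ hK W' _ _ hW' p hp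
  obtain ⟨C, rfl⟩ := hW'
  -- the square-root generator of the CM field: `θ² = d_K`, `θ ∉ ℚ`
  obtain ⟨θ, hθ⟩ := hK.2
  have hd : cmFieldDiscr W.j < 0 := cmFieldDiscr_neg hj
  have hθ' : θ ∉ Set.range (algebraMap ℚ K) := by
    rintro ⟨q, hq⟩
    have h1 : (algebraMap ℚ K) (q ^ 2) = (algebraMap ℚ K) (cmFieldDiscr W.j : ℚ) := by
      rw [map_pow, hq, hθ, map_intCast]
    have h2 : q ^ 2 = (cmFieldDiscr W.j : ℚ) := (algebraMap ℚ K).injective h1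
    have h3 : (0 : ℚ) ≤ q ^ 2 := sq_nonneg q
    have h4 : ((cmFieldDiscr W.j : ℤ) : ℚ) < 0 := by exact_mod_cast hd
    linarith
  have hc : θ ^ 2 = algebraMap ℚ K (cmFieldDiscr W.j : ℚ) := by rw [hθ, map_intCast]
  have hd0 : (cmFieldDiscr W.j : ℚ) ≠ 0 := by exact_mod_cast hd.ne
  -- `E(ℚ)` and `E^{(d_K)}(ℚ)` are finite (Coates–Wiles, for `E` and for its twist)
  have hfinQ : Finite W.toAffine.Point := hF1 W hj hL
  haveI : (W.quadraticTwist (cmFieldDiscr W.j : ℚ)).IsElliptic := W.isElliptic_quadraticTwist hd0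
  have hjd : (W.quadraticTwist (cmFieldDiscr W.j : ℚ)).j ∈ maximalCMJInvariants := by
    rw [W.j_quadraticTwist hd0]
    exact hj
  have hLd : (W.quadraticTwist (cmFieldDiscr W.j : ℚ)).entireLFunction 1 ≠ 0 := by
    rw [← entireLFunction_eq_of_isIsogenous hKn (hTW W hj)]
    exact hL
  have hfinQd : Finite (W.quadraticTwist (cmFieldDiscr W.j : ℚ)).toAffine.Point :=
    hF1 (W.quadraticTwist (cmFieldDiscr W.j : ℚ)) hjd hLd
  -- hence `E(K)` is finite, and so is `W'(K) ≅ E(K)`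
  have hfinK : Finite (W.baseChange K).toAffine.Point :=
    W.finite_point_baseChange_of_finite_of_finite_quadraticTwist hK.1 hθ' hc hfinQ hfinQd
  have hfinW' : Finite (C • W.baseChange K).toAffine.Point :=
    Finite.of_equiv _ (VariableChange.pointEquiv (W.baseChange K) C).toEquiv
  -- `L(E_K/K, 1) = L(E/ℚ, 1)² ≠ 0`, so Rubin 1987 §10 applies to `E_K`
  have hLK : (W.baseChange K).entireLFunction 1 ≠ 0 := by
    rw [entireLFunction_one_eq_sq_of_LFunction_eq_mul_self (hmod W) (hD W hj K hK)]
    exact pow_ne_zero 2 hL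
  have hprim : Set.Finite {c : (W.baseChange K).sha | ∃ j : ℕ, p ^ j • c = 0} :=
    hR W hj K hK hLK p hp
  exact ⟨hfinW', ((W.baseChange K).finite_sha_primary_variableChange_iff C p).mpr hprim⟩

/-- **bsd.S28 from the `p`-part leaf and classical facts only.**
`bsdTriple_of_j_mem_maximalCMJInvariants_of_L_one_ne_zero` follows, sorry-free, from
Burungale–Flach, Prop. 2.3 with Lemma 13 at `F = K` for every `p`
(`hB : BurungaleFlach2024_main_cmField_pPart`, the Iwasawa-theoretic heart) and the classical
named facts: Rubin 1987 §10 (`hR`), Coates–Wiles finiteness over `ℚ` (`hF1`), the CM period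
lattice (`hΛ`), Deuring (`hD`), modularity (`hmod`), Artin formalism (`hBCL`), Milne's theorem on
Weil restriction (`hBC`), Cassels' isogeny invariance (`hISO`), Knapp 11.67 (`hKn`), `L(E,1) ≥ 0`
(`hPOS`) and the CM twist isogeny (`hTW`) — through
`BurungaleFlach2024_finite_primary_cmField_of_classical` and the level-4 assembly
`bsdTriple_of_j_mem_maximalCMJInvariants_of_L_one_ne_zero_of_halves`.
[cite: BurungaleFlach2024, Thm. 1.1 and its proof, Cor. 1, Cor. 2 (arXiv pp. 3–4, 19, 22)] -/
theorem bsdTriple_of_j_mem_maximalCMJInvariants_of_L_one_ne_zero_of_pPart_of_classical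
    (hB : BurungaleFlach2024_main_cmField_pPart) (hR : Rubin1987_sha_primary_finite)
    (hF1 : finite_point_of_j_mem_maximalCMJInvariants_of_L_one_ne_zero)
    (hΛ : exists_isCMPeriod_of_j_mem_maximalCMJInvariants)
    (hD : Deuring_LFunction_baseChange_cmField) (hmod : hasEntireLFunction_rat)
    (hBCL : LSeries_baseChange_quadratic) (hBC : bsdRHS_baseChange_quadratic)
    (hISO : bsdRHS_eq_of_isIsogenous) (hKn : LFunction_eq_of_isIsogenous)
    (hPOS : re_entireLFunction_one_nonneg) (hTW : isIsogenous_quadraticTwist_cmFieldDiscr) :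
    bsdTriple_of_j_mem_maximalCMJInvariants_of_L_one_ne_zero :=
  bsdTriple_of_j_mem_maximalCMJInvariants_of_L_one_ne_zero_of_halves
    (BurungaleFlach2024_finite_primary_cmField_of_classical hF1 hTW hKn hR hD hmod) hB hΛ hD hmod
    hBCL hBC hISO hKn hPOS hTW

/-- **bsd.S28 from the `p`-part leaf and printed classical sources.** As
`bsdTriple_of_j_mem_maximalCMJInvariants_of_L_one_ne_zero_of_pPart_of_classical`, with the
Coates–Wiles finiteness input itself taken from its printed form
(`hCW : CoatesWiles1977_L_one_eq_zero_of_not_isOfFinAddOrder`, Invent. Math. 39 (1977), Thm. 1,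
§6) and the Mordell–Weil theorem over `ℚ` (`hMW`, Silverman *AEC* VIII.6.7), through the parent
file's `finite_point_of_j_mem_maximalCMJInvariants_of_L_one_ne_zero_of_facts`.
[cite: BurungaleFlach2024, Thm. 1.1 and its proof, Cor. 1, Cor. 2 (arXiv pp. 3–4, 19, 22)]
[cite: CoatesWiles1977, Thm 1 (p. 223)] -/
theorem bsdTriple_of_j_mem_maximalCMJInvariants_of_L_one_ne_zero_of_pPart_of_printed_sources
    (hB : BurungaleFlach2024_main_cmField_pPart) (hR : Rubin1987_sha_primary_finite)
    (hMW : ∀ (W : WeierstrassCurve ℚ) [W.IsElliptic], W.module_finite_point)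
    (hCW : CoatesWiles1977_L_one_eq_zero_of_not_isOfFinAddOrder)
    (hΛ : exists_isCMPeriod_of_j_mem_maximalCMJInvariants)
    (hD : Deuring_LFunction_baseChange_cmField) (hmod : hasEntireLFunction_rat)
    (hBCL : LSeries_baseChange_quadratic) (hBC : bsdRHS_baseChange_quadratic)
    (hISO : bsdRHS_eq_of_isIsogenous) (hKn : LFunction_eq_of_isIsogenous)
    (hPOS : re_entireLFunction_one_nonneg) (hTW : isIsogenous_quadraticTwist_cmFieldDiscr) :
    bsdTriple_of_j_mem_maximalCMJInvariants_of_L_one_ne_zero :=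
  bsdTriple_of_j_mem_maximalCMJInvariants_of_L_one_ne_zero_of_pPart_of_classical hB hR
    (finite_point_of_j_mem_maximalCMJInvariants_of_L_one_ne_zero_of_facts hMW hCW) hΛ hD hmod hBCL
    hBC hISO hKn hPOS hTW

end Literature.NumberTheory.EllipticCurves

end
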